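import Mathlib
import HarnessLib
import Summits.RiemannHypothesis.RiemannHypothesis.Theses.CharacterSums
import Literature.NumberTheory.LFunctions.ConreyCharacterSumsRH

/-!
# Birth skeleton (BC3) for crux `ConreyPositivity` — route CharacterSums, item stmt-RiemannHypothesis-16980

Crux (FIXED, the route's decl, rank 2):
`ConreyPositivity : ∀ q prime, q % 8 = 3 → ∀ x ∈ [0, 1/4], 0 ≤ ∑' n, (n/q) sin(2πnx)/n²`.

Line `birth` = the route header's foreseen first layer
"ConreyPositivity ⇐ FiniteForm → CesaroMax → ConreyPositivity" (Conrey 2024 = arXiv:2404.19647,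
Thm 4 / Cor 1 and the finite inequality `S_q(N) ≤ S_q(q/2) = h(−q)` on `0 < N ≤ q/4`), with the
classical non-negativity of the class-number side split off so that the OPEN content is one named
stub over `N ∈ [1, q/4]`:

* `stub_finiteForm : FiniteForm` — the route's own support item (stmt-RiemannHypothesis-16983),
  Conrey 2024 Thm 4 / Cor 1 for prime `q ≡ 3 (mod 8)`, `x ≥ 0`:
  `f_q(x) = (2π²x/√q)(S_q(q/2) − S_q(qx))`. Provable now (Fourier series of the Bernoulli-type
  kernel + Gauss sum of the real primitive character + `L_q(1) = (π/√q) S_q(q/2)`). Size L.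
* `stub_classNumberSide_nonneg : ∀ q prime, q % 8 = 3 → 0 ≤ S_q(q/2)` — Dirichlet:
  `S_q(q/2) = (√q/π) L(1, χ_{−q}) > 0` (`= h(−q)` for `q > 3`; `= 1/3` at `q = 3`). Needed exactly
  for the window `0 < qx < 1`, where `S_q(qx)` is the empty sum. Known; size M
  (Mathlib: `DirichletCharacter.LFunction` at 1, non-vanishing / positivity for real characters).
* `stub_cesaroMax : ∀ q prime, q % 8 = 3 → ∀ N : ℝ, 1 ≤ N → N ≤ q/4 → S_q(N) ≤ S_q(q/2)` — THE
  CONTENT (hardest stub): the Cesàro character sum on `[1, q/4]` never exceeds the class-number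
  side. Open (Conrey Conj 1 ∩ Thm 3 in finite form; Bober-verified for `q < 10⁹`, Conrey Remark 2).
  CAVEAT recorded on the item (evidence `idea-imitation-cuts-both-ways.md`, idea-node g17,
  2026-08-17): a numerical certificate (x₀ = 1/4096, M = 2²⁰, λ flipped on the primes in
  (2048, 4096)) indicates the crux AS STATED fails at some astronomically large imitating prime
  `q ≡ 3 (mod 8)`; if that refutation lands, this stub is the one it kills (the other two are
  theorems in print), and under the route's declared repair (imitating-subsequence form) the same
  three-piece cut applies with `q` restricted.

`ConreyPositivity_of` is a REAL proof (no sorry): rewrite by the finite form, `2π²x/√q ≥ 0`, and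
the bracket is `≥ 0` by `stub_classNumberSide_nonneg` when `qx < 1` (empty Cesàro sum,
`Conrey2024.S_of_lt_one`) and by `stub_cesaroMax` at `N = qx ∈ [1, q/4]` otherwise.

Disproof used: none relevant (no `Disproof.lean` / `Negative/` lemma exists for this crux at
registration time; `ledger crux ls` showed no workfiles).
-/

set_option linter.dupNamespace false

namespace Summit.RiemannHypothesis.RiemannHypothesis.Cruxes.ConreyPositivity.Birth

open Summit.RiemannHypothesis.RiemannHypothesis.Theses.CharacterSums
open Literature.NumberTheory.LFunctions

/-- stub 1 (support item FiniteForm = Conrey 2024 Thm 4 / Cor 1, prime modulus form):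
for prime `q ≡ 3 (mod 8)` and `x ≥ 0`, `f_q(x) = (2π²x/√q)(S_q(q/2) − S_q(qx))`. -/
theorem stub_finiteForm : FiniteForm := by
  sorry

/-- stub 2 (Dirichlet, class-number side): `S_q(q/2) = (√q/π)·L(1,χ_{−q}) ≥ 0` for prime
`q ≡ 3 (mod 8)`. -/
theorem stub_classNumberSide_nonneg :
    ∀ q : ℕ, q.Prime → q % 8 = 3 → 0 ≤ Conrey2024.S q ((q : ℝ) / 2) := by
  sorry

/-- stub 3 (THE CONTENT — Conrey's finite inequality on the window that Theorem 3 consumes):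
for prime `q ≡ 3 (mod 8)` and real `N ∈ [1, q/4]`, `S_q(N) ≤ S_q(q/2)`. -/
theorem stub_cesaroMax :
    ∀ q : ℕ, q.Prime → q % 8 = 3 → ∀ N : ℝ, 1 ≤ N → N ≤ (q : ℝ) / 4 →
      Conrey2024.S q N ≤ Conrey2024.S q ((q : ℝ) / 2) := by
  sorry

/-! ### Stub statements by name

The skeleton gate reads the composition's hypotheses BY NAME: each must be a registered obligation
(`FiniteForm`, the route's support item) or a declared stub. The `abbrev`s below are the stubs'
exact elaborated types (`type_of%`), so `ConreyPositivity_of` takes `(h : FiniteForm)`,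
`(h : Statement.stub_classNumberSide_nonneg)`, `(h : Statement.stub_cesaroMax)` and nothing else. -/

namespace Statement

/-- Statement of `stub_finiteForm` (it is the route item `FiniteForm` itself). -/
abbrev stub_finiteForm : Prop := type_of% @Birth.stub_finiteForm
/-- Statement of `stub_classNumberSide_nonneg`. -/
abbrev stub_classNumberSide_nonneg : Prop := type_of% @Birth.stub_classNumberSide_nonneg
/-- Statement of `stub_cesaroMax`. -/
abbrev stub_cesaroMax : Prop := type_of% @Birth.stub_cesaroMax

end Statement

/-! ### The crux from the stubs (kernel-checked composition, sorry-free) -/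

/-- ASSEMBLY: the three stub statements give the crux `ConreyPositivity` (the route decl, by name).
Rewrite the series by Conrey's finite form (stub 1); the prefactor `2π²x/√q` is `≥ 0`; the bracket
`S_q(q/2) − S_q(qx)` is `≥ 0` by stub 2 when `qx < 1` (empty Cesàro sum) and by stub 3 at
`N = qx ∈ [1, q/4]` otherwise. [folklore] -/
theorem ConreyPositivity_of (hF : FiniteForm) (hPos : Statement.stub_classNumberSide_nonneg)
    (hMax : Statement.stub_cesaroMax) :
    _root_.Summit.RiemannHypothesis.RiemannHypothesis.Theses.CharacterSums.ConreyPositivity := by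
  unfold Summit.RiemannHypothesis.RiemannHypothesis.Theses.CharacterSums.ConreyPositivity
  intro q hq h8 x hx0 hx4
  -- the bracket `S_q(q/2) - S_q(qx)` is non-negative
  have key : 0 ≤ Conrey2024.S q ((q : ℝ) / 2) - Conrey2024.S q ((q : ℝ) * x) := by
    rw [sub_nonneg]
    by_cases h1 : (q : ℝ) * x < 1
    · rw [Conrey2024.S_of_lt_one q h1]
      exact hPos q hq h8
    · have h1 : 1 ≤ (q : ℝ) * x := not_lt.mp h1
      have h4 : (q : ℝ) * x ≤ (q : ℝ) / 4 := by
        have : (q : ℝ) * x ≤ (q : ℝ) * (1 / 4) :=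
          mul_le_mul_of_nonneg_left hx4 (Nat.cast_nonneg q)
        linarith
      exact hMax q hq h8 _ h1 h4
  -- Conrey's finite form (stub 1) turns the series into `(2π²x/√q)·bracket`
  rw [hF q hq h8 x hx0]
  have hc : 0 ≤ 2 * Real.pi ^ 2 * x / Real.sqrt q := by positivity
  exact mul_nonneg hc key

/-- The crux along this line, MODULO exactly the three registered stubs (depends on `sorryAx` only
through `stub_*`; NOT a proof — calibration that the composition consumes the stubs as declared).
[folklore] -/
theorem ConreyPositivity_along_birth :
    _root_.Summit.RiemannHypothesis.RiemannHypothesis.Theses.CharacterSums.ConreyPositivity :=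
  ConreyPositivity_of stub_finiteForm stub_classNumberSide_nonneg stub_cesaroMax

end Summit.RiemannHypothesis.RiemannHypothesis.Cruxes.ConreyPositivity.Birth
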